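import Mathlib
import Summits.ValiantsHypothesis.ValiantsHypothesis.Theorems.FifoMatchingNNLowDegreeCofactorHardSupportGenericExpBound
import HarnessLib

/-!
# Crux `FifoMatching.NNLowDegreeCofactorHard` (stmt-ValiantsHypothesis-22993), line `freed-vertices`:
# the registered stub `stub_supportGenericQPHard` (S3) — support-generic, linearly robust
# quasi-polynomial hardness of `NN`

The line `Cruxes/NNLowDegreeCofactorHard/Lines/freed_vertices.lean` reduces the crux (every
nonzero cofactor `h` of bounded degree leaves `NN_n · h` quasi-polynomially hard over `ℝ≥0`) to
three stubs; this file proves the third one BY NAME: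

* `stub_supportGenericQPHard` — for all `r, c` and all large `n`, every `g ∈ ℝ≥0[x_(i,j)]` on
  `[2n']` with EXACTLY the support of `NN_{n'}`, where `n ≤ (r+1)(n'+2)`, has monotone complexity
  `L₊(g) > 2^((log₂ n + c)^c)`.

Proof: `exp_lower_bound_of_support_eq` (`2^{n'^{1/6}} ≤ L₊(g)` for `n' ≥ n₁`, the support-generic
form of the PROVED bound of stmt-22994, helper file `…SupportGenericExpBound.lean`) and growth
arithmetic with `k = log₂ n`: `(r+1)(((k+c)^c+1)^6+2) < 2^k ≤ n ≤ (r+1)(n'+2)` for large `k`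
(`eventually_growth_lt_two_pow`), so `((log₂ n + c)^c + 1)^6 ≤ n'` and
`2^((log₂ n + c)^c + 1) ≤ 2^{n'^{1/6}} ≤ L₊(g)`.

Honest framing: bookkeeping over a PROVED monotone rung; the crux 22993 closes only together with
the other two stubs of the line (`stub_cofactorBuysVertices`, `stub_carveInterval`), and VP ≠ VNP
is not moved by this file (monotone ≠ general, `Literature.Barriers.ValiantsHypothesis.MonotoneGap`).
No definitions, no named facts.
-/

noncomputable section

-- Sub = Summit single-conjunct layout: the duplicated namespace component is mandated by the tree.
set_option linter.dupNamespace false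

namespace Summit.ValiantsHypothesis.ValiantsHypothesis.Theorems.FifoMatching.NNLowDegreeCofactorHard

open MvPolynomial Finset Filter Literature.Computability.AlgebraicComplexity
open Summit.ValiantsHypothesis.ValiantsHypothesis.Theorems.FifoMatching.NNMonotoneHard
open scoped NNReal Topology

/-! ### Growth arithmetic -/

/-- `(r+1) · (((k+c)^c + 1)^6 + 2) < 2^k` for all large `k` (a polynomial in `k` against `2^k`).
[folklore] -/
theorem eventually_growth_lt_two_pow (r c : ℕ) :
    ∃ k₀ : ℕ, ∀ k : ℕ, k₀ ≤ k → (r + 1) * (((k + c) ^ c + 1) ^ 6 + 2) < 2 ^ k := by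
  set B : ℕ := (r + 1) * (((c + 1) ^ c + 1) ^ 6 + 2) with hB
  have E := eventually_const_mul_pow_mul_pow_lt (6 * c) (C := (B : ℝ)) (a := 1 / 2)
    (by norm_num) (by norm_num) one_pos
  obtain ⟨k₀, hk₀⟩ := Filter.eventually_atTop.1 ((eventually_ge_atTop 1).and E)
  refine ⟨k₀, fun k hk => ?_⟩
  obtain ⟨hk1, hE⟩ := hk₀ k hk
  -- crude bound in `ℕ`: `(r+1)(((k+c)^c+1)^6+2) ≤ B · k^{6c}` for `k ≥ 1`
  have h1 : k + c ≤ (c + 1) * k := by nlinarith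
  have h2 : (k + c) ^ c ≤ (c + 1) ^ c * k ^ c := by
    calc (k + c) ^ c ≤ ((c + 1) * k) ^ c := Nat.pow_le_pow_left h1 c
      _ = (c + 1) ^ c * k ^ c := mul_pow _ _ _
  have hkc : 1 ≤ k ^ c := Nat.one_le_pow _ _ hk1
  have h3 : (k + c) ^ c + 1 ≤ ((c + 1) ^ c + 1) * k ^ c := by nlinarith
  have h4 : ((k + c) ^ c + 1) ^ 6 ≤ ((c + 1) ^ c + 1) ^ 6 * k ^ (6 * c) := by
    calc ((k + c) ^ c + 1) ^ 6 ≤ (((c + 1) ^ c + 1) * k ^ c) ^ 6 := Nat.pow_le_pow_left h3 6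
      _ = ((c + 1) ^ c + 1) ^ 6 * k ^ (6 * c) := by rw [mul_pow, ← pow_mul, Nat.mul_comm c 6]
  have hk6c : 1 ≤ k ^ (6 * c) := Nat.one_le_pow _ _ hk1
  have h5 : (r + 1) * (((k + c) ^ c + 1) ^ 6 + 2) ≤ B * k ^ (6 * c) := by
    rw [hB, mul_assoc]
    apply Nat.mul_le_mul_left
    nlinarith
  -- the real comparison `B k^{6c} < 2^k`
  have h2k : (0 : ℝ) < (2 : ℝ) ^ k := by positivity
  have hR : (B : ℝ) * (k : ℝ) ^ (6 * c) < (2 : ℝ) ^ k := by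
    have h := hE
    rw [one_div, inv_pow, ← div_eq_mul_inv, div_lt_one h2k] at h
    exact h
  have hlt : B * k ^ (6 * c) < 2 ^ k := by exact_mod_cast hR
  exact lt_of_le_of_lt h5 hlt

/-! ### The registered stub -/

/-- **S3 — `stub_supportGenericQPHard` of line `freed-vertices` (registered signature, verbatim):
support-generic, linearly robust quasi-polynomial hardness of `NN`.**  For all `r, c` and all
large `n`: every `g ∈ ℝ≥0[x]` with exactly the support of `NN_{n'}`, where `n ≤ (r+1)(n'+2)`,
has `L₊(g) > 2^((log₂ n + c)^c)`.  Proof: `exp_lower_bound_of_support_eq` (`2^{n'^{1/6}} ≤ L₊(g)`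
for `n' ≥ n₁`) and `eventually_growth_lt_two_pow` with `k = Nat.log 2 n`
(`(r+1)(((k+c)^c+1)^6+2) < 2^k ≤ n ≤ (r+1)(n'+2)` gives `((log₂ n + c)^c + 1)^6 ≤ n'`, hence
`2^((log₂ n + c)^c + 1) ≤ 2^{n'^{1/6}} ≤ L₊(g)`); `n₀ = max (2^{k₀}, (r+1)(n₁+2))`. [folklore] -/
theorem stub_supportGenericQPHard :
    ∀ r c : ℕ, ∃ n₀ : ℕ, ∀ n ≥ n₀, ∀ n' : ℕ, n ≤ (r + 1) * (n' + 2) →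
      ∀ g : MvPolynomial (Fin (2 * n') × Fin (2 * n')) ℝ≥0,
        g.support = (nestFreeMatchingPoly n' ℝ≥0).support →
          2 ^ ((Nat.log 2 n + c) ^ c) < complexity g := by
  intro r c
  obtain ⟨n₁, hn₁⟩ := exp_lower_bound_of_support_eq
  obtain ⟨k₀, hk₀⟩ := eventually_growth_lt_two_pow r c
  refine ⟨max (2 ^ k₀) ((r + 1) * (n₁ + 2)), fun n hn n' hn' g hg => ?_⟩
  have hn2 : 2 ^ k₀ ≤ n := le_trans (le_max_left _ _) hn
  have hn3 : (r + 1) * (n₁ + 2) ≤ n := le_trans (le_max_right _ _) hn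
  -- `n' ≥ n₁`
  have hn'1 : n₁ ≤ n' := by
    have h := Nat.le_of_mul_le_mul_left (hn3.trans hn') (Nat.succ_pos r)
    omega
  -- `k = log₂ n ≥ k₀`, `2^k ≤ n`
  set k := Nat.log 2 n with hk
  have hnpos : n ≠ 0 := by
    have : 0 < 2 ^ k₀ := by positivity
    omega
  have hk₀k : k₀ ≤ k := Nat.le_log_of_pow_le (by norm_num) hn2
  have h2k : 2 ^ k ≤ n := Nat.pow_log_le_self 2 hnpos
  have hgrow := hk₀ k hk₀k
  set A := (k + c) ^ c with hA
  -- `(A+1)^6 ≤ n'`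
  have hA6 : (A + 1) ^ 6 ≤ n' := by
    have h1 : (r + 1) * ((A + 1) ^ 6 + 2) ≤ (r + 1) * (n' + 2) := by
      calc (r + 1) * ((A + 1) ^ 6 + 2) ≤ 2 ^ k := hgrow.le
        _ ≤ n := h2k
        _ ≤ (r + 1) * (n' + 2) := hn'
    have := Nat.le_of_mul_le_mul_left h1 (Nat.succ_pos r)
    omega
  -- `A + 1 ≤ n'^{1/6}`
  have hroot : (((A + 1 : ℕ) : ℝ)) ≤ (n' : ℝ) ^ ((1 : ℝ) / 6) := by
    have hcast : (((A + 1 : ℕ) : ℝ)) ^ 6 ≤ (n' : ℝ) := by exact_mod_cast hA6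
    have h := Real.rpow_le_rpow (by positivity) hcast (by norm_num : (0 : ℝ) ≤ 1 / 6)
    have h6 : ((((A + 1 : ℕ) : ℝ)) ^ 6) ^ ((1 : ℝ) / 6) = ((A + 1 : ℕ) : ℝ) := by
      rw [show ((1 : ℝ) / 6) = ((6 : ℕ) : ℝ)⁻¹ by norm_num]
      exact Real.pow_rpow_inv_natCast (by positivity) (by norm_num)
    rw [h6] at h
    exact h
  have hmain := hn₁ n' hn'1 g hg
  have hfinal : (((2 ^ (A + 1) : ℕ) : ℝ)) ≤ (complexity g : ℝ) := by
    calc (((2 ^ (A + 1) : ℕ) : ℝ)) = (2 : ℝ) ^ (((A + 1 : ℕ) : ℝ)) := by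
          rw [Real.rpow_natCast]; push_cast; ring
      _ ≤ (2 : ℝ) ^ ((n' : ℝ) ^ ((1 : ℝ) / 6)) :=
          Real.rpow_le_rpow_of_exponent_le (by norm_num) hroot
      _ ≤ _ := hmain
  have hfinal' : 2 ^ (A + 1) ≤ complexity g := by exact_mod_cast hfinal
  calc 2 ^ ((Nat.log 2 n + c) ^ c) = 2 ^ A := by rw [hA]
    _ < 2 ^ (A + 1) := Nat.pow_lt_pow_right (by norm_num) (by omega)
    _ ≤ complexity g := hfinal'

end Summit.ValiantsHypothesis.ValiantsHypothesis.Theorems.FifoMatching.NNLowDegreeCofactorHard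

end
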